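import Literature.AlgebraicGeometry.ShimuraVarieties.UnitaryBallRationalSubconeDensity
import Mathlib.Algebra.Order.BigOperators.Ring.Finset
import HarnessLib

/-!
# [MR92] §5 Lemma B + Corollary C on the negative cone in EVERY signature `(p, 1)`, `p ≥ 2`
# (the printed generality «n ≥ 2»; sequel of `UnitaryBallRationalSubconeDensity`, which did `p = 2`)

Topic `AlgebraicGeometry/ShimuraVarieties`; namespace `Literature.AlgebraicGeometry.ShimuraVarieties` (helpers in the grouping
sub-namespace `RationalSubconeGeneralRank`, heads dotted on `UnitaryBallUniformisationDatum`). THEOREMS ONLY: no definition, no named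
fact, no instance, no `sorry`.

[MurtyRamakrishnan1992] §5 (pp. 461–463) is printed for a hermitian space of signature `(n, 1)`, any `n ≥ 2`; ★
`UnitaryBallRationalSubconeDensity` formalised the cone-side core (Lemma A, Lemma B with [Liu2021] fn. 9 «n − 1», the pointwise half of
Cor. C) at `p = 2` and left `-- TODO(general form)`.  This file removes the restriction on the rank:

* `RationalSubconeGeneralRank.re_hermForm_self_pos_of_orthogonal_of_mem_negCone` — in signature `(p,1)` (a Sylvester frame
  `Tᴴ Hc T = diag(1,…,1,−1)`), a non-zero vector orthogonal to a negative vector is POSITIVE («Φ is positive definite on `Z = ṽ^⊥`»,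
  p. 462): `p`-term Cauchy–Schwarz (Mathlib `Finset.sum_mul_sq_le_sq_mul_sq`).
* `RationalSubconeGeneralRank.exists_orthogonal_positive_pair` — for `p ≥ 2`, through a very special `v₀ ∈ E^{p+1}` there are
  `E`-rational `w₀ ⟂ w₀'` in `v₀^⊥`, both positive at `τ₁` (Gram–Schmidt twice; only `dim v₀^⊥ = p ≥ 2` is used).
* **`UnitaryBallUniformisationDatum.linearForm_eq_zero_of_smul_rational_of_forall_line_of_two_le`** — for
  `D : UnitaryBallUniformisationDatum p X`, `2 ≤ p`: a field of `ℂ`-linear forms `F` on the cone which, for EVERY totally positive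
  definite `E`-LINE `W`, kills `W^⊥ ⊗ ℂ` at every point of the special sub-cone `D.cone ∩ (W^⊥ ⊗ ℂ)`, vanishes at every point of the
  cone on an `E`-rational line.  The proof is the hyperplane form of Lemma B: at such a `v`, with `w₀ ⟂ w₀'` as above, `F v` kills the
  hyperplanes `K = (ℂ τ₁w₀)^⊥ ∋ v` and `K' = (ℂ τ₁w₀')^⊥ ∋ τ₁w₀`, and every `t` splits as `(t − c · τ₁w₀) + c · τ₁w₀ ∈ K + K'` with
  `c = ⟪τ₁w₀, t⟫ / ⟪τ₁w₀, τ₁w₀⟫` — so `F v = 0` (no spanning-set bookkeeping, unlike the `p = 2` file).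
* `UnitaryBallUniformisationDatum.linearForm_eq_zero_of_forall_line_of_two_le` — with continuity of `u ↦ F u t` on the cone, `F = 0`
  on the whole cone (Lemma A, rank-free ★ `RationalSubcone.exists_rational_mem_inter_negCone`).

No consumer in the cell at `p > 2` today (the crux files are surfaces); this is the printed statement's generality, banked.

## References
* [MurtyRamakrishnan1992] V. K. Murty, D. Ramakrishnan, *The Albanese of unitary Shimura varieties* (CRM Montréal 1992), §5 Lemma B
  and Cor. C (pp. 462–463) — for signature `(n, 1)`, `n ≥ 2`.
* [Liu2021] Y. Liu, Camb. J. Math. 9 (2021), proof of Thm. 4.15, footnote 9 («n − 1»).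
* [BergeronMillsonMoeglin2016Balls] N. Bergeron, J. Millson, C. Moeglin, Acta Math. 216 (2016), Part 2 §§1.1–1.3, 3.1.
-/

set_option autoImplicit false

noncomputable section

open Matrix NumberField Complex
open scoped ComplexOrder ComplexConjugate

namespace Literature.AlgebraicGeometry.ShimuraVarieties

open Literature.AlgebraicGeometry.Motives (SchemeOver)

namespace RationalSubconeGeneralRank

/-! ### §0 Sesquilinearity (private plumbing) -/

section Sesq

variable {m : Type*} [Fintype m] (Hc : Matrix m m ℂ)

/-- `⟪u, v + v'⟫ = ⟪u, v⟫ + ⟪u, v'⟫`. [folklore] -/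
private theorem hermForm_add_right (u v v' : m → ℂ) :
    hermForm (starRingEnd ℂ) Hc u (v + v') = hermForm (starRingEnd ℂ) Hc u v + hermForm (starRingEnd ℂ) Hc u v' := by
  rw [hermForm_starRingEnd, hermForm_starRingEnd, hermForm_starRingEnd, mulVec_add, dotProduct_add]

/-- `⟪u, v - v'⟫ = ⟪u, v⟫ - ⟪u, v'⟫`. [folklore] -/
private theorem hermForm_sub_right (u v v' : m → ℂ) :
    hermForm (starRingEnd ℂ) Hc u (v - v') = hermForm (starRingEnd ℂ) Hc u v - hermForm (starRingEnd ℂ) Hc u v' := by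
  rw [hermForm_starRingEnd, hermForm_starRingEnd, hermForm_starRingEnd, mulVec_sub, dotProduct_sub]

/-- `⟪u, c • v⟫ = c ⟪u, v⟫`. [folklore] -/
private theorem hermForm_smul_right (c : ℂ) (u v : m → ℂ) :
    hermForm (starRingEnd ℂ) Hc u (c • v) = c * hermForm (starRingEnd ℂ) Hc u v := by
  rw [hermForm_starRingEnd, hermForm_starRingEnd, mulVec_smul, dotProduct_smul, smul_eq_mul]

/-- `⟪c • u, v⟫ = c̄ ⟪u, v⟫`. [folklore] -/
private theorem hermForm_smul_left (c : ℂ) (u v : m → ℂ) :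
    hermForm (starRingEnd ℂ) Hc (c • u) v = starRingEnd ℂ c * hermForm (starRingEnd ℂ) Hc u v := by
  rw [hermForm_starRingEnd, hermForm_starRingEnd, star_smul, smul_dotProduct, smul_eq_mul, Complex.star_def]

variable {Hc}

/-- `conj ⟪u, v⟫ = ⟪v, u⟫` for a hermitian Gram matrix. [folklore] -/
private theorem conj_hermForm (hH : Hc.IsHermitian) (u v : m → ℂ) :
    starRingEnd ℂ (hermForm (starRingEnd ℂ) Hc u v) = hermForm (starRingEnd ℂ) Hc v u := by
  rw [hermForm_starRingEnd, hermForm_starRingEnd, ← Complex.star_def, star_dotProduct, star_star, star_mulVec,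
    ← dotProduct_mulVec, hH.eq]

/-- `⟪u, v⟫ = 0 ↔ ⟪v, u⟫ = 0` for a hermitian Gram matrix. [folklore] -/
private theorem hermForm_eq_zero_comm (hH : Hc.IsHermitian) (u v : m → ℂ) :
    hermForm (starRingEnd ℂ) Hc u v = 0 ↔ hermForm (starRingEnd ℂ) Hc v u = 0 := by
  constructor <;> intro h
  · rw [← conj_hermForm hH, h, map_zero]
  · rw [← conj_hermForm hH, h, map_zero]

end Sesq

section SesqE

variable {R : Type*} [CommRing R] {m : Type*} [Fintype m] (σ : R →+* R) (H : Matrix m m R)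

/-- `⟪u, v - v'⟫ = ⟪u, v⟫ - ⟪u, v'⟫` over any ring. [folklore] -/
private theorem hermForm_sub_right' (u v v' : m → R) :
    hermForm σ H u (v - v') = hermForm σ H u v - hermForm σ H u v' := by
  simp only [hermForm, mulVec_sub, dotProduct_sub]

/-- `⟪u, c • v⟫ = c ⟪u, v⟫` over any ring. [folklore] -/
private theorem hermForm_smul_right' (c : R) (u v : m → R) : hermForm σ H u (c • v) = c * hermForm σ H u v := by
  simp only [hermForm, mulVec_smul, dotProduct_smul, smul_eq_mul]

end SesqE

/-! ### §1 The form in a Sylvester frame of signature `(p, 1)` -/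

section Frame

variable {p : ℕ} {Hc T Ti : Matrix (Fin (p + 1)) (Fin (p + 1)) ℂ}

/-- Transport of the form to a frame: if `Tᴴ Hc T = S` and `T Ti = 1` then `⟪x, y⟫_{Hc} = ⟪Ti x, Ti y⟫_S`.
[cite: BergeronMillsonMoeglin2016Balls, Part 2 §1.1] -/
theorem hermForm_eq_frame {S : Matrix (Fin (p + 1)) (Fin (p + 1)) ℂ} (hT : Tᴴ * Hc * T = S) (hTi : T * Ti = 1)
    (x y : Fin (p + 1) → ℂ) :
    hermForm (starRingEnd ℂ) Hc x y = hermForm (starRingEnd ℂ) S (Ti *ᵥ x) (Ti *ᵥ y) := by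
  have hHc : Hc = Tiᴴ * S * Ti := by
    rw [← hT]
    calc Hc = (T * Ti)ᴴ * Hc * (T * Ti) := by rw [hTi, conjTranspose_one, Matrix.one_mul, Matrix.mul_one]
      _ = Tiᴴ * (Tᴴ * Hc * T) * Ti := by rw [conjTranspose_mul]; simp only [Matrix.mul_assoc]
  rw [hermForm_starRingEnd, hermForm_starRingEnd, hHc, star_mulVec, ← dotProduct_mulVec, mulVec_mulVec, mulVec_mulVec]

/-- The standard form of signature `(p, 1)` evaluated: `ā ⬝ (S b) = Σ_{i<p} āᵢ bᵢ − ā_p b_p` for `S = diag(1, …, 1, −1)`.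
[cite: BergeronMillsonMoeglin2016Balls, Part 2 §1.1] -/
theorem hermForm_signatureMatrix (a b : Fin (p + 1) → ℂ) :
    hermForm (starRingEnd ℂ) (signatureMatrix p) a b =
      (∑ i : Fin p, starRingEnd ℂ (a (Fin.castSucc i)) * b (Fin.castSucc i)) -
        starRingEnd ℂ (a (Fin.last p)) * b (Fin.last p) := by
  rw [hermForm_starRingEnd, signatureMatrix, dotProduct, Fin.sum_univ_castSucc]
  have h1 : ∀ i : Fin p, (Fin.castSucc i = Fin.last p) = False := fun i ↦ by
    simp [(Fin.castSucc_lt_last i).ne]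
  simp only [mulVec_diagonal, Pi.star_apply, Complex.star_def, h1, if_false, if_true, one_mul, neg_one_mul,
    mul_neg]
  ring

/-- The standard form on the diagonal: `Re ⟪a, a⟫_S = Σ_{i<p} |aᵢ|² − |a_p|²`. [cite: BergeronMillsonMoeglin2016Balls, Part 2 §1.1] -/
theorem re_hermForm_signatureMatrix_self (a : Fin (p + 1) → ℂ) :
    (hermForm (starRingEnd ℂ) (signatureMatrix p) a a).re =
      (∑ i : Fin p, ‖a (Fin.castSucc i)‖ ^ 2) - ‖a (Fin.last p)‖ ^ 2 := by
  rw [hermForm_signatureMatrix, Complex.sub_re, Complex.re_sum]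
  congr 1
  · refine Finset.sum_congr rfl fun i _ ↦ ?_
    rw [Complex.conj_mul', ← Complex.ofReal_pow, Complex.ofReal_re]
  · rw [Complex.conj_mul', ← Complex.ofReal_pow, Complex.ofReal_re]

/-- **«`Φ` is positive definite on `Z = ṽ^⊥`» in signature `(p, 1)`** ([MR92] p. 462): with a Sylvester frame `Tᴴ Hc T = diag(1,…,1,−1)`,
`T` invertible, if `v` is NEGATIVE and `w ≠ 0` is orthogonal to `v` then `w` is POSITIVE.  In the frame `ā_p b_p = Σ_{i<p} āᵢ bᵢ` with
`|a_p|² > Σ |aᵢ|²`; if `|b_p|² ≥ Σ |bᵢ|²`, Cauchy–Schwarz in `p` terms forces `b = 0`.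
[cite: MurtyRamakrishnan1992, §5 proof of Lemma B (p. 462)] -/
theorem re_hermForm_self_pos_of_orthogonal_of_mem_negCone (hT : Tᴴ * Hc * T = signatureMatrix p) (hTi : T * Ti = 1)
    {v w : Fin (p + 1) → ℂ} (hv : v ∈ negCone Hc) (hw : w ≠ 0) (horth : hermForm (starRingEnd ℂ) Hc v w = 0) :
    0 < (hermForm (starRingEnd ℂ) Hc w w).re := by
  set a : Fin (p + 1) → ℂ := Ti *ᵥ v with ha_def
  set b : Fin (p + 1) → ℂ := Ti *ᵥ w with hb_def
  -- the real quantities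
  set A : ℝ := ∑ i : Fin p, ‖a (Fin.castSucc i)‖ ^ 2 with hA
  set α : ℝ := ‖a (Fin.last p)‖ with hα
  set B : ℝ := ∑ i : Fin p, ‖b (Fin.castSucc i)‖ ^ 2 with hB
  set β : ℝ := ‖b (Fin.last p)‖ with hβ
  set C : ℝ := ∑ i : Fin p, ‖a (Fin.castSucc i)‖ * ‖b (Fin.castSucc i)‖ with hC
  have hvv : (hermForm (starRingEnd ℂ) Hc v v).re = A - α ^ 2 := by
    rw [hermForm_eq_frame hT hTi, re_hermForm_signatureMatrix_self]
  have hww : (hermForm (starRingEnd ℂ) Hc w w).re = B - β ^ 2 := by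
    rw [hermForm_eq_frame hT hTi, re_hermForm_signatureMatrix_self]
  have hneg : A - α ^ 2 < 0 := by rw [← hvv]; exact hv
  have hab : starRingEnd ℂ (a (Fin.last p)) * b (Fin.last p) =
      ∑ i : Fin p, starRingEnd ℂ (a (Fin.castSucc i)) * b (Fin.castSucc i) := by
    have h := horth
    rw [hermForm_eq_frame hT hTi, hermForm_signatureMatrix] at h
    rw [← ha_def, ← hb_def] at h
    exact (sub_eq_zero.1 h).symm
  -- `α β ≤ C`, `C² ≤ A B`
  have hcross : α * β ≤ C := by
    have h : ‖starRingEnd ℂ (a (Fin.last p)) * b (Fin.last p)‖ =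
        ‖∑ i : Fin p, starRingEnd ℂ (a (Fin.castSucc i)) * b (Fin.castSucc i)‖ := by rw [hab]
    rw [norm_mul, RCLike.norm_conj] at h
    rw [hα, hβ, h, hC]
    refine (norm_sum_le _ _).trans (le_of_eq (Finset.sum_congr rfl fun i _ ↦ ?_))
    rw [norm_mul, RCLike.norm_conj]
  have hCS : C ^ 2 ≤ A * B := by
    rw [hC, hA, hB]
    exact Finset.sum_mul_sq_le_sq_mul_sq _ _ _
  have hA0 : 0 ≤ A := Finset.sum_nonneg fun i _ ↦ sq_nonneg _
  have hB0 : 0 ≤ B := Finset.sum_nonneg fun i _ ↦ sq_nonneg _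
  have hα0 : 0 ≤ α := norm_nonneg _
  have hβ0 : 0 ≤ β := norm_nonneg _
  have hC0 : 0 ≤ C := Finset.sum_nonneg fun i _ ↦ mul_nonneg (norm_nonneg _) (norm_nonneg _)
  rw [hww]
  by_contra hle
  push Not at hle
  -- `(α β)² ≤ C² ≤ A B ≤ A β²`, hence `(α² − A) β² ≤ 0`, so `β = 0`, so `B = 0`, so `b = 0`
  have h1 : (α * β) ^ 2 ≤ C ^ 2 := pow_le_pow_left₀ (mul_nonneg hα0 hβ0) hcross 2
  have h2 : A * B ≤ A * β ^ 2 := mul_le_mul_of_nonneg_left (by linarith) hA0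
  have hβsq : β ^ 2 ≤ 0 := by nlinarith [h1, hCS, h2, sq_nonneg β]
  have hβ' : β = 0 := by nlinarith [sq_nonneg β]
  have hB' : B = 0 := le_antisymm (by nlinarith) hB0
  have hb : b = 0 := by
    funext i
    rw [Pi.zero_apply]
    rcases Fin.eq_castSucc_or_eq_last i with ⟨j, rfl⟩ | rfl
    · have hle' : ‖b (Fin.castSucc j)‖ ^ 2 ≤ B :=
        Finset.single_le_sum (f := fun i : Fin p ↦ ‖b (Fin.castSucc i)‖ ^ 2) (fun i _ ↦ sq_nonneg _)
          (Finset.mem_univ j)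
      have hj : ‖b (Fin.castSucc j)‖ ^ 2 = 0 := le_antisymm (by rw [hB'] at hle'; exact hle') (sq_nonneg _)
      exact norm_eq_zero.1 ((pow_eq_zero_iff two_ne_zero).1 hj)
    · have h0 : ‖b (Fin.last p)‖ = 0 := by rw [hβ] at hβ'; exact hβ'
      exact norm_eq_zero.1 h0
  apply hw
  calc w = (T * Ti) *ᵥ w := by rw [hTi, one_mulVec]
    _ = T *ᵥ b := by rw [← mulVec_mulVec]
    _ = 0 := by rw [hb, mulVec_zero]

end Frame

/-! ### §2 Lemma B, `E`-side, any rank `p ≥ 2` -/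

section Rational

variable (E : Subfield ℂ) [NumberField E] [IsCMField E] {p : ℕ} (H : Matrix (Fin (p + 1)) (Fin (p + 1)) E)

/-- `⟪τ₁ u, τ₁ v⟫_{H^{τ₁}} = τ₁ ⟪u, v⟫_H`. [cite: BergeronMillsonMoeglin2016Balls, Part 2 §1.1] -/
theorem hermForm_coe_coe (u v : Fin (p + 1) → E) :
    hermForm (starRingEnd ℂ) (H.map E.subtype) (fun i ↦ (u i : ℂ)) (fun i ↦ (v i : ℂ)) =
      ((hermForm (conjRingHom E) H u v : E) : ℂ) :=
  (map_hermForm E.subtype (embedding_conjRingHom E E.subtype) H u v).symm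

/-- **Lemma B, `E`-side, in signature `(p, 1)` with `p ≥ 2`** ([MR92] p. 462 with [Liu2021] fn. 9): through a very special
`v₀ ∈ E^{p+1}` (`τ₁ v₀` negative) there are `E`-rational `w₀, w₀' ∈ v₀^⊥`, orthogonal to each other, both POSITIVE at `τ₁`
(Gram–Schmidt twice; all self-pairings non-zero by §1). [cite: MurtyRamakrishnan1992, §5 Lemma B (p. 462)]
[cite: Liu2021, proof of Thm. 4.15, footnote 9] -/
theorem exists_orthogonal_positive_pair (hp : 2 ≤ p)
    (hsig : ∃ T : GL (Fin (p + 1)) ℂ,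
      (T : Matrix (Fin (p + 1)) (Fin (p + 1)) ℂ)ᴴ * H.map E.subtype * (T : Matrix (Fin (p + 1)) (Fin (p + 1)) ℂ) =
        signatureMatrix p)
    (v₀ : Fin (p + 1) → E) (hv : (fun i ↦ (v₀ i : ℂ)) ∈ negCone (H.map E.subtype)) :
    ∃ w₀ w₀' : Fin (p + 1) → E, w₀ ≠ 0 ∧ w₀' ≠ 0 ∧
      hermForm (conjRingHom E) H v₀ w₀ = 0 ∧ hermForm (conjRingHom E) H v₀ w₀' = 0 ∧
      hermForm (conjRingHom E) H w₀ w₀' = 0 ∧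
      0 < (hermForm (starRingEnd ℂ) (H.map E.subtype) (fun i ↦ (w₀ i : ℂ)) (fun i ↦ (w₀ i : ℂ))).re ∧
      0 < (hermForm (starRingEnd ℂ) (H.map E.subtype) (fun i ↦ (w₀' i : ℂ)) (fun i ↦ (w₀' i : ℂ))).re := by
  obtain ⟨T, hT⟩ := hsig
  have hTi : (T : Matrix (Fin (p + 1)) (Fin (p + 1)) ℂ) * ((T⁻¹ : GL (Fin (p + 1)) ℂ) : Matrix _ _ ℂ) = 1 := by
    rw [← Units.val_mul, mul_inv_cancel, Units.val_one]
  set q : E := hermForm (conjRingHom E) H v₀ v₀ with hq_def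
  have hq : q ≠ 0 := by
    intro h
    have h' : (hermForm (starRingEnd ℂ) (H.map E.subtype) (fun i ↦ (v₀ i : ℂ)) (fun i ↦ (v₀ i : ℂ))).re < 0 := hv
    rw [hermForm_coe_coe] at h'
    have h0 : (hermForm (conjRingHom E) H v₀ v₀ : E) = 0 := h
    rw [h0, ZeroMemClass.coe_zero, Complex.zero_re] at h'
    exact lt_irrefl _ h'
  have hpos : ∀ w : Fin (p + 1) → E, w ≠ 0 → hermForm (conjRingHom E) H v₀ w = 0 →
      0 < (hermForm (starRingEnd ℂ) (H.map E.subtype) (fun i ↦ (w i : ℂ)) (fun i ↦ (w i : ℂ))).re := by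
    intro w hw h0
    refine re_hermForm_self_pos_of_orthogonal_of_mem_negCone hT hTi hv ?_ ?_
    · intro h
      apply hw
      funext i
      have hi := congr_fun h i
      simp only [Pi.zero_apply] at hi
      rw [Pi.zero_apply]
      exact_mod_cast hi
    · rw [hermForm_coe_coe, h0, ZeroMemClass.coe_zero]
  -- first vector: outside the line `E ∙ v₀` (a proper subspace since `p + 1 ≥ 2`)
  have hlt₁ : (E ∙ v₀ : Submodule E (Fin (p + 1) → E)) < ⊤ := by
    refine lt_top_iff_ne_top.2 fun h ↦ ?_
    have h1 : Module.finrank E (Submodule.span E ({v₀} : Set (Fin (p + 1) → E))) ≤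
        ({v₀} : Set (Fin (p + 1) → E)).toFinset.card := finrank_span_le_card _
    rw [Set.toFinset_singleton, Finset.card_singleton, h, finrank_top, Module.finrank_fintype_fun_eq_card,
      Fintype.card_fin] at h1
    omega
  obtain ⟨u, -, hu⟩ := SetLike.exists_of_lt hlt₁
  set w₀ : Fin (p + 1) → E := q • u - hermForm (conjRingHom E) H v₀ u • v₀ with hw₀_def
  have hvw₀ : hermForm (conjRingHom E) H v₀ w₀ = 0 := by
    rw [hw₀_def, hermForm_sub_right', hermForm_smul_right', hermForm_smul_right', ← hq_def]
    ring
  have hw₀ : w₀ ≠ 0 := by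
    intro h
    apply hu
    rw [hw₀_def, sub_eq_zero] at h
    rw [Submodule.mem_span_singleton]
    refine ⟨q⁻¹ * hermForm (conjRingHom E) H v₀ u, ?_⟩
    rw [mul_smul, ← h, smul_smul, inv_mul_cancel₀ hq, one_smul]
  have hw₀pos := hpos w₀ hw₀ hvw₀
  set qw : E := hermForm (conjRingHom E) H w₀ w₀ with hqw_def
  have hqw : qw ≠ 0 := by
    intro h
    have h' := hw₀pos
    rw [hermForm_coe_coe] at h'
    have h0 : (hermForm (conjRingHom E) H w₀ w₀ : E) = 0 := h
    rw [h0, ZeroMemClass.coe_zero, Complex.zero_re] at h'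
    exact lt_irrefl _ h'
  -- second vector: outside the plane `span {v₀, w₀}` (a proper subspace since `p + 1 ≥ 3`)
  have hlt₂ : (Submodule.span E {v₀, w₀} : Submodule E (Fin (p + 1) → E)) < ⊤ := by
    refine lt_top_iff_ne_top.2 fun h ↦ ?_
    have h1 : Module.finrank E (Submodule.span E ({v₀, w₀} : Set (Fin (p + 1) → E))) ≤
        ({v₀, w₀} : Set (Fin (p + 1) → E)).toFinset.card := finrank_span_le_card _
    have h2 : ({v₀, w₀} : Set (Fin (p + 1) → E)).toFinset.card ≤ 2 := by
      rw [Set.toFinset_insert, Set.toFinset_singleton]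
      exact Finset.card_le_two
    rw [h, finrank_top, Module.finrank_fintype_fun_eq_card, Fintype.card_fin] at h1
    omega
  obtain ⟨u', -, hu'⟩ := SetLike.exists_of_lt hlt₂
  set z : Fin (p + 1) → E := q • u' - hermForm (conjRingHom E) H v₀ u' • v₀ with hz_def
  have hvz : hermForm (conjRingHom E) H v₀ z = 0 := by
    rw [hz_def, hermForm_sub_right', hermForm_smul_right', hermForm_smul_right', ← hq_def]
    ring
  set w₀' : Fin (p + 1) → E := qw • z - hermForm (conjRingHom E) H w₀ z • w₀ with hw₀'_def
  have hvw₀' : hermForm (conjRingHom E) H v₀ w₀' = 0 := by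
    rw [hw₀'_def, hermForm_sub_right', hermForm_smul_right', hermForm_smul_right', hvz, hvw₀]
    ring
  have hww₀' : hermForm (conjRingHom E) H w₀ w₀' = 0 := by
    rw [hw₀'_def, hermForm_sub_right', hermForm_smul_right', hermForm_smul_right', ← hqw_def]
    ring
  have hw₀' : w₀' ≠ 0 := by
    intro h
    apply hu'
    rw [hw₀'_def, sub_eq_zero] at h
    have hz : z = (qw⁻¹ * hermForm (conjRingHom E) H w₀ z) • w₀ := by
      rw [mul_smul, ← h, smul_smul, inv_mul_cancel₀ hqw, one_smul]
    have hqu : q • u' = hermForm (conjRingHom E) H v₀ u' • v₀ + (qw⁻¹ * hermForm (conjRingHom E) H w₀ z) • w₀ := by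
      rw [← hz, hz_def]
      abel
    rw [Submodule.mem_span_pair]
    refine ⟨q⁻¹ * hermForm (conjRingHom E) H v₀ u', q⁻¹ * (qw⁻¹ * hermForm (conjRingHom E) H w₀ z), ?_⟩
    rw [mul_smul, mul_smul, ← smul_add, ← hqu, smul_smul, inv_mul_cancel₀ hq, one_smul]
  exact ⟨w₀, w₀', hw₀, hw₀', hvw₀, hvw₀', hww₀', hw₀pos, hpos w₀' hw₀' hvw₀'⟩

end Rational

end RationalSubconeGeneralRank

/-! ### §3 Corollary C, pointwise, in every signature `(p, 1)`, `p ≥ 2` -/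

namespace UnitaryBallUniformisationDatum

open RationalSubconeGeneralRank

variable {p : ℕ} {X : SchemeOver ℂ} (D : UnitaryBallUniformisationDatum p X)

/-- The orthogonality clause of a line `E ∙ w₀` reduces to its generator (any rank). [cite: BergeronMillsonMoeglin2016Balls, Part 2 §3.1] -/
theorem forall_mem_span_singleton_hermForm_eq_zero_iff_of_rank (w₀ : Fin (p + 1) → D.E) (t : Fin (p + 1) → ℂ) :
    (∀ w ∈ (D.E ∙ w₀ : Submodule D.E (Fin (p + 1) → D.E)), hermForm (starRingEnd ℂ) D.Hℂ (fun i ↦ (w i : ℂ)) t = 0) ↔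
      hermForm (starRingEnd ℂ) D.Hℂ (fun i ↦ (w₀ i : ℂ)) t = 0 := by
  constructor
  · intro h
    exact h w₀ (Submodule.mem_span_singleton_self w₀)
  · intro h w hw
    obtain ⟨a, rfl⟩ := Submodule.mem_span_singleton.1 hw
    have hcoe : (fun i ↦ ((a • w₀) i : ℂ)) = (a : ℂ) • fun i ↦ (w₀ i : ℂ) := by
      funext i
      simp only [Pi.smul_apply, smul_eq_mul, Subfield.coe_mul]
    rw [hcoe, hermForm_smul_left, h, mul_zero]

/-- **[MR92] §5 Lemma B + Cor. C on the cone, EVERY signature `(p, 1)` with `p ≥ 2`, at the very special points** (pp. 462–463):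
for `D : UnitaryBallUniformisationDatum p X` and a field `F` of `ℂ`-linear forms on `ℂ^{p+1}` which, for EVERY totally positive
definite `E`-line `W`, kills `W^⊥ ⊗ ℂ` at every point of the special sub-cone `D.cone ∩ (W^⊥ ⊗ ℂ)` (clauses spelled as III-8′'s
`IsCompatibleSpecialSource.orthogonal` reads on the cone), `F v = 0` at every cone point `v = c · τ₁v₀` on an `E`-rational line.
Proof (hyperplane form of Lemma B): §2 gives `E`-rational `w₀ ⟂ w₀'` in `v₀^⊥`, both spanning totally positive lines
(★ `isTotallyPositive_span_singleton`); `F v` kills `K = (ℂτ₁w₀)^⊥ ∋ v` and `K' = (ℂτ₁w₀')^⊥ ∋ v, τ₁w₀`; and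
`t = (t − c·τ₁w₀) + c·τ₁w₀ ∈ K + K'` with `c = ⟪τ₁w₀, t⟫/⟪τ₁w₀, τ₁w₀⟫`.
[cite: MurtyRamakrishnan1992, §5 Lemma B and Cor. C (pp. 462–463)] [cite: Liu2021, proof of Thm. 4.15, footnote 9] -/
theorem linearForm_eq_zero_of_smul_rational_of_forall_line_of_two_le (hp : 2 ≤ p)
    (F : (Fin (p + 1) → ℂ) → (Fin (p + 1) → ℂ) →ₗ[ℂ] ℂ)
    (hF : ∀ W : Submodule D.E (Fin (p + 1) → D.E), IsTotallyPositive (conjRingHom D.E) D.H W → Module.finrank D.E W = 1 →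
      ∀ u ∈ D.cone, (∀ w ∈ W, hermForm (starRingEnd ℂ) D.Hℂ (fun i ↦ (w i : ℂ)) u = 0) →
        ∀ t : Fin (p + 1) → ℂ, (∀ w ∈ W, hermForm (starRingEnd ℂ) D.Hℂ (fun i ↦ (w i : ℂ)) t = 0) → F u t = 0)
    {v : Fin (p + 1) → ℂ} (hv : v ∈ D.cone) {c : ℂ} {v₀ : Fin (p + 1) → D.E} (hcv : v = c • fun i ↦ (v₀ i : ℂ)) :
    F v = 0 := by
  have hHerm : D.Hℂ.IsHermitian := D.isHermitian_Hℂ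
  -- `c ≠ 0` and `τ₁ v₀` is negative
  have hc : c ≠ 0 := by
    rintro rfl
    rw [zero_smul] at hcv
    have h : (hermForm (starRingEnd ℂ) D.Hℂ v v).re < 0 := hv
    rw [hcv, hermForm_starRingEnd, star_zero, zero_dotProduct, Complex.zero_re] at h
    exact lt_irrefl _ h
  have hv₀ : (fun i ↦ (v₀ i : ℂ)) ∈ D.cone := by
    have h := smul_mem_negCone (inv_ne_zero hc) hv
    rwa [hcv, smul_smul, inv_mul_cancel₀ hc, one_smul] at h
  obtain ⟨w₀, w₀', hw₀, hw₀', hvw₀, hvw₀', hww₀', hpos, hpos'⟩ :=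
    exists_orthogonal_positive_pair D.E D.H hp D.signature_τ₁ v₀ hv₀
  set w : Fin (p + 1) → ℂ := fun i ↦ (w₀ i : ℂ) with hw_def
  set w' : Fin (p + 1) → ℂ := fun i ↦ (w₀' i : ℂ) with hw'_def
  -- orthogonality over `ℂ`
  have hvw : hermForm (starRingEnd ℂ) D.Hℂ v w = 0 := by
    rw [hcv, hw_def, hermForm_smul_left, hermForm_coe_coe, hvw₀, ZeroMemClass.coe_zero, mul_zero]
  have hvw' : hermForm (starRingEnd ℂ) D.Hℂ v w' = 0 := by
    rw [hcv, hw'_def, hermForm_smul_left, hermForm_coe_coe, hvw₀', ZeroMemClass.coe_zero, mul_zero]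
  have hww' : hermForm (starRingEnd ℂ) D.Hℂ w w' = 0 := by
    rw [hw_def, hw'_def, hermForm_coe_coe, hww₀']; rfl
  have hwv : hermForm (starRingEnd ℂ) D.Hℂ w v = 0 := (hermForm_eq_zero_comm hHerm v w).1 hvw
  have hw'v : hermForm (starRingEnd ℂ) D.Hℂ w' v = 0 := (hermForm_eq_zero_comm hHerm v w').1 hvw'
  have hw'w : hermForm (starRingEnd ℂ) D.Hℂ w' w = 0 := (hermForm_eq_zero_comm hHerm w w').1 hww'
  have hww : hermForm (starRingEnd ℂ) D.Hℂ w w ≠ 0 := by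
    intro h
    have h' := hpos
    change 0 < (hermForm (starRingEnd ℂ) D.Hℂ w w).re at h'
    rw [h, Complex.zero_re] at h'
    exact lt_irrefl _ h'
  -- the two totally positive lines and the vanishing of `F v` on their orthogonal hyperplanes
  have hW : IsTotallyPositive (conjRingHom D.E) D.H (D.E ∙ w₀) :=
    isTotallyPositive_span_singleton D.E D.H D.posDef_of_ne hw₀ hpos
  have hW' : IsTotallyPositive (conjRingHom D.E) D.H (D.E ∙ w₀') :=
    isTotallyPositive_span_singleton D.E D.H D.posDef_of_ne hw₀' hpos'
  have h1 : Module.finrank D.E (D.E ∙ w₀ : Submodule D.E (Fin (p + 1) → D.E)) = 1 := finrank_span_singleton hw₀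
  have h1' : Module.finrank D.E (D.E ∙ w₀' : Submodule D.E (Fin (p + 1) → D.E)) = 1 := finrank_span_singleton hw₀'
  have hK : ∀ t, hermForm (starRingEnd ℂ) D.Hℂ w t = 0 → F v t = 0 := fun t ht ↦
    hF _ hW h1 v hv ((D.forall_mem_span_singleton_hermForm_eq_zero_iff_of_rank w₀ v).2 hwv) t
      ((D.forall_mem_span_singleton_hermForm_eq_zero_iff_of_rank w₀ t).2 ht)
  have hK' : ∀ t, hermForm (starRingEnd ℂ) D.Hℂ w' t = 0 → F v t = 0 := fun t ht ↦
    hF _ hW' h1' v hv ((D.forall_mem_span_singleton_hermForm_eq_zero_iff_of_rank w₀' v).2 hw'v) t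
      ((D.forall_mem_span_singleton_hermForm_eq_zero_iff_of_rank w₀' t).2 ht)
  -- the decomposition `t = (t − c' • w) + c' • w`, `c' = ⟪w, t⟫ / ⟪w, w⟫`
  refine LinearMap.ext fun t ↦ ?_
  set c' : ℂ := hermForm (starRingEnd ℂ) D.Hℂ w t / hermForm (starRingEnd ℂ) D.Hℂ w w with hc'
  have ht₁ : hermForm (starRingEnd ℂ) D.Hℂ w (t - c' • w) = 0 := by
    rw [hermForm_sub_right, hermForm_smul_right, hc', div_mul_cancel₀ _ hww, sub_self]
  have ht₂ : hermForm (starRingEnd ℂ) D.Hℂ w' (c' • w) = 0 := by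
    rw [hermForm_smul_right, hw'w, mul_zero]
  have hsplit : t = (t - c' • w) + c' • w := by abel
  rw [LinearMap.zero_apply, hsplit, map_add, hK _ ht₁, hK' _ ht₂, add_zero]

/-- **[MR92] §5 Lemma A + Lemma B + Cor. C on the cone, every signature `(p, 1)` with `p ≥ 2`**: if moreover `u ↦ F u t` is
continuous on the cone for each `t`, then `F = 0` on the whole cone (the `E`-rational points are dense, ★
`RationalSubcone.exists_rational_mem_inter_negCone`). [cite: MurtyRamakrishnan1992, §5 Lemma A, Lemma B, Cor. C (pp. 461–463)] -/
theorem linearForm_eq_zero_of_forall_line_of_two_le (hp : 2 ≤ p)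
    (F : (Fin (p + 1) → ℂ) → (Fin (p + 1) → ℂ) →ₗ[ℂ] ℂ)
    (hcont : ∀ t : Fin (p + 1) → ℂ, ContinuousOn (fun u ↦ F u t) D.cone)
    (hF : ∀ W : Submodule D.E (Fin (p + 1) → D.E), IsTotallyPositive (conjRingHom D.E) D.H W → Module.finrank D.E W = 1 →
      ∀ u ∈ D.cone, (∀ w ∈ W, hermForm (starRingEnd ℂ) D.Hℂ (fun i ↦ (w i : ℂ)) u = 0) →
        ∀ t : Fin (p + 1) → ℂ, (∀ w ∈ W, hermForm (starRingEnd ℂ) D.Hℂ (fun i ↦ (w i : ℂ)) t = 0) → F u t = 0)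
    (u : Fin (p + 1) → ℂ) (hu : u ∈ D.cone) : F u = 0 := by
  refine LinearMap.ext fun t ↦ ?_
  rw [LinearMap.zero_apply]
  by_contra hne
  have hopen : IsOpen (D.cone ∩ (fun u' ↦ F u' t) ⁻¹' {z : ℂ | z ≠ 0}) :=
    (hcont t).isOpen_inter_preimage (isOpen_negCone _) isOpen_ne
  obtain ⟨v₀, hv₀O, hv₀c⟩ := RationalSubcone.exists_rational_mem_inter_negCone D.E D.Hℂ hopen ⟨u, ⟨hu, hne⟩, hu⟩
  have h0 := D.linearForm_eq_zero_of_smul_rational_of_forall_line_of_two_le hp F hF hv₀c (c := 1) (v₀ := v₀) (by rw [one_smul])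
  exact hv₀O.2 (by change F (fun i ↦ (v₀ i : ℂ)) t = 0; rw [h0, LinearMap.zero_apply])

end UnitaryBallUniformisationDatum

end Literature.AlgebraicGeometry.ShimuraVarieties

end
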